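import Mathlib
import HarnessLib
import Summits.ResolutionOfSingularities.ResolutionOfSingularities.Theorems.HomologicalConductorPersistenceRecurrenceExclusion

/-!
# Ω-recurrence certificates: a COVERING recurrent class decides `ca(T)` exactly — the kernel form of
# «(Rec) + (IW-p) ⇒ Sat₄» at a rational surface stage

Route `ResolutionOfSingularities/HomologicalConductor`, chain W4.4b, rung S-2 `PersistenceSurface`
(stmt-ResolutionOfSingularities-19970), stub C1 (`Sat₄`) / the census proviso; seat res-L1-w44b-stub-2 (gen 5),
row «Ω-recurrence certificates — kernel shape».  [OURS · L1 w44b; AI-written, weaker than expert review; NOT a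
statement of the manuscript under study (Hironaka 2017), and no statement of that manuscript is used.]

Continuation of `…PersistenceRecurrenceExclusion` (p554202).  There a RECURRENT class `𝒞` (every member
finitely generated, `hfin`, and a retract of a first syzygy module of a member, `hrec`) was shown to consist of
retracts of `n`-th syzygy modules for every `n`, so that `ca(T)` stably annihilates every member.  Here the
class is assumed in addition to COVER the `d`-th syzygies (`hcov`: every `Ωᵈ M`, `M` finitely generated, is a
retract of a member) — the shape of the chain's two census inputs at a rational normal surface stage: the
Ω-digraph on the finitely many indecomposable special Cohen–Macaulay modules («every member is a summand of `Ω`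
of a member», tri-2 S2-REC-ENGINE / stub-3 «`S₃ ⊆ S₄`», e.g. `S160`: `Ω D₁ = D₂²⊕D₄²⊕N*²`, …) and the class
inclusion «`Ωᵈ(mod T) ⊆ add 𝒞`» ((IW-p)).  Then:

* `cohomologyAnnihilatorOfDegree_eq_of_recurrent_of_cover` — `caⁿ(T) = caᵈ⁺¹(T)` for every `n ≥ d + 1`;
* **`cohomologyAnnihilator_eq_of_recurrent_of_cover`** — `ca(T) = caᵈ⁺¹(T)` (`Sat_{d+1}`, no level left to
  test);
* **`mem_cohomologyAnnihilator_iff_forall_stablyAnnihilates_of_recurrent_of_cover`** — `x ∈ ca(T)` iff `x`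
  stably annihilates every member: the finite Ω-digraph data decide `ca(T)` EXACTLY (KEPT and LOST alike);
* appendix `stablyAnnihilates_of_isSyzygy_of_stablyAnnihilates` — `s̲ann(X) ⊆ s̲ann(Ωˢ X)` (the engines'
  «eventual image» step), `stablyAnnihilates_of_retract_of_isSyzygy`, `stablyAnnihilates_iff_of_retract_isSyzygy`;
* family forms for a class given as `X : ι → ModuleCat T` (the engines' finite lists):
  `mem_cohomologyAnnihilator_iff_forall_stablyAnnihilates_family` (`ca(T) = ⋂ⱼ s̲ann(X j)`) and
  `not_mem_cohomologyAnnihilatorOfDegree_family` (one non-annihilated `X j₀` ⇒ `x ∉ caᵐ(T)` for all `m`).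

References (mechanism only): S. B. Iyengar, R. Takahashi, IMRN 2016, arXiv:1404.1476, §2
[`IyengarTakahashi2014`].
-/

noncomputable section

-- single-problem summit: the doubled namespace component `ResolutionOfSingularities` is forced
set_option linter.dupNamespace false

namespace Summit.ResolutionOfSingularities.ResolutionOfSingularities.Theorems.HomologicalConductor.RecurrenceCover

open CategoryTheory CategoryTheory.Abelian Literature.RingTheory.CohomologyAnnihilator
open Summit.ResolutionOfSingularities.ResolutionOfSingularities.Theorems.NoZeno.SandwichCluster
open Summit.ResolutionOfSingularities.ResolutionOfSingularities.Theorems.HomologicalConductor.CompletionAscentSyzygyRetract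
open Summit.ResolutionOfSingularities.ResolutionOfSingularities.Theorems.HomologicalConductor.RecurrenceExclusion

universe u

variable {T : Type u} [CommRing T] [IsNoetherianRing T] (𝒞 : ModuleCat.{u} T → Prop)

/-- **`(Rec) + (cover) ⇒ Sat`, levelled.** Let `𝒞` be a recurrent class (`hfin`, `hrec`) which COVERS the
`d`-th syzygies (`hcov`).  Then `caⁿ(T) = caᵈ⁺¹(T)` for every `n ≥ d + 1`: an element of `caⁿ(T)` stably
annihilates every member (a retract of an `(n-1)`-th syzygy module, `exists_retract_isSyzygy_of_recurrent`),
hence every `d`-th syzygy module (HC-R), hence lies in `caᵈ⁺¹(T)` (CA1). [folklore] -/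
theorem cohomologyAnnihilatorOfDegree_eq_of_recurrent_of_cover (d : ℕ)
    (hfin : ∀ X, 𝒞 X → Module.Finite T X)
    (hrec : ∀ X, 𝒞 X → ∃ (Y N : ModuleCat.{u} T) (i : X ⟶ N) (r : N ⟶ X),
      𝒞 Y ∧ IsSyzygy 1 Y N ∧ i ≫ r = 𝟙 X)
    (hcov : ∀ (M K : ModuleCat.{u} T), Module.Finite T M → IsSyzygy d M K →
      ∃ (X : ModuleCat.{u} T) (i : K ⟶ X) (r : X ⟶ K), 𝒞 X ∧ i ≫ r = 𝟙 K)
    {n : ℕ} (hn : d + 1 ≤ n) :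
    cohomologyAnnihilatorOfDegree T n = cohomologyAnnihilatorOfDegree T (d + 1) := by
  refine le_antisymm ?_ (cohomologyAnnihilatorOfDegree_mono hn)
  obtain ⟨m, rfl⟩ : ∃ m, n = m + 1 := ⟨n - 1, by omega⟩
  intro x hx
  rw [mem_cohomologyAnnihilatorOfDegree_succ_iff_forall_isSyzygy]
  intro M K hM hK
  obtain ⟨X, i, r, hX, hir⟩ := hcov M K hM hK
  exact StablyAnnihilates.of_retract i r hir
    (stablyAnnihilates_of_mem_cohomologyAnnihilatorOfDegree_succ_of_recurrent 𝒞 hfin hrec hx hX)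

/-- **`(Rec) + (cover) ⇒ Sat`**: under the same hypotheses `ca(T) = caᵈ⁺¹(T)`. [folklore] -/
theorem cohomologyAnnihilator_eq_of_recurrent_of_cover (d : ℕ)
    (hfin : ∀ X, 𝒞 X → Module.Finite T X)
    (hrec : ∀ X, 𝒞 X → ∃ (Y N : ModuleCat.{u} T) (i : X ⟶ N) (r : N ⟶ X),
      𝒞 Y ∧ IsSyzygy 1 Y N ∧ i ≫ r = 𝟙 X)
    (hcov : ∀ (M K : ModuleCat.{u} T), Module.Finite T M → IsSyzygy d M K →
      ∃ (X : ModuleCat.{u} T) (i : K ⟶ X) (r : X ⟶ K), 𝒞 X ∧ i ≫ r = 𝟙 K) :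
    cohomologyAnnihilator T = cohomologyAnnihilatorOfDegree T (d + 1) := by
  refine le_antisymm ?_ (cohomologyAnnihilatorOfDegree_le _)
  intro x hx
  obtain ⟨n, hn⟩ := mem_cohomologyAnnihilator_iff.mp hx
  have hx' : x ∈ cohomologyAnnihilatorOfDegree T (max n (d + 1)) :=
    cohomologyAnnihilatorOfDegree_mono (le_max_left _ _) hn
  rwa [cohomologyAnnihilatorOfDegree_eq_of_recurrent_of_cover 𝒞 d hfin hrec hcov (le_max_right _ _)] at hx'

/-- **The common stable annihilator of a covering recurrent class IS the cohomology annihilator**: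
`x ∈ ca(T)` iff `x` stably annihilates every member of `𝒞` (`⇒`: recurrence; `⇐`: the cover and CA1 at
level `d`).  So the finite Ω-digraph data decide `ca(T)` exactly. [folklore] -/
theorem mem_cohomologyAnnihilator_iff_forall_stablyAnnihilates_of_recurrent_of_cover (d : ℕ)
    (hfin : ∀ X, 𝒞 X → Module.Finite T X)
    (hrec : ∀ X, 𝒞 X → ∃ (Y N : ModuleCat.{u} T) (i : X ⟶ N) (r : N ⟶ X),
      𝒞 Y ∧ IsSyzygy 1 Y N ∧ i ≫ r = 𝟙 X)
    (hcov : ∀ (M K : ModuleCat.{u} T), Module.Finite T M → IsSyzygy d M K →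
      ∃ (X : ModuleCat.{u} T) (i : K ⟶ X) (r : X ⟶ K), 𝒞 X ∧ i ≫ r = 𝟙 K) (x : T) :
    x ∈ cohomologyAnnihilator T ↔ ∀ X, 𝒞 X → StablyAnnihilates T x X := by
  constructor
  · intro hx X hX
    exact stablyAnnihilates_of_mem_cohomologyAnnihilator_of_recurrent 𝒞 hfin hrec hx hX
  · intro h
    refine cohomologyAnnihilatorOfDegree_le (d + 1)
      ((mem_cohomologyAnnihilatorOfDegree_succ_iff_forall_isSyzygy x).mpr fun M K hM hK => ?_)
    obtain ⟨X, i, r, hX, hir⟩ := hcov M K hM hK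
    exact StablyAnnihilates.of_retract i r hir (h X hX)

/-- The level-`(d+1)` form of the converse: if `x` stably annihilates every member of a class covering the
`d`-th syzygies, then `x ∈ caᵈ⁺¹(T)` (no recurrence needed). [folklore] -/
theorem mem_cohomologyAnnihilatorOfDegree_succ_of_forall_stablyAnnihilates_of_cover (d : ℕ)
    (hcov : ∀ (M K : ModuleCat.{u} T), Module.Finite T M → IsSyzygy d M K →
      ∃ (X : ModuleCat.{u} T) (i : K ⟶ X) (r : X ⟶ K), 𝒞 X ∧ i ≫ r = 𝟙 K) {x : T}
    (h : ∀ X, 𝒞 X → StablyAnnihilates T x X) : x ∈ cohomologyAnnihilatorOfDegree T (d + 1) := by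
  refine (mem_cohomologyAnnihilatorOfDegree_succ_iff_forall_isSyzygy x).mpr fun M K hM hK => ?_
  obtain ⟨X, i, r, hX, hir⟩ := hcov M K hM hK
  exact StablyAnnihilates.of_retract i r hir (h X hX)

/-! ## Family form: `ca(T) = ⋂ᵢ s̲ann(Xᵢ)` as ideals -/

omit [IsNoetherianRing T] in
/-- The stable annihilator of a module is closed under addition (add the two factorisations through
`P₁ ⊕ P₂`). [folklore] -/
theorem stablyAnnihilates_add {x y : T} {M : ModuleCat.{u} T} (hx : StablyAnnihilates T x M)
    (hy : StablyAnnihilates T y M) : StablyAnnihilates T (x + y) M := by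
  obtain ⟨P₁, hP₁, hproj₁, ι₁, π₁, h₁⟩ := hx
  obtain ⟨P₂, hP₂, hproj₂, ι₂, π₂, h₂⟩ := hy
  haveI := hP₁
  haveI := hP₂
  refine ⟨ModuleCat.of T (P₁ × P₂), inferInstance, projective_prod hproj₁ hproj₂,
    ModuleCat.ofHom (ι₁.hom.prod ι₂.hom), ModuleCat.ofHom (π₁.hom.coprod π₂.hom), ?_⟩
  apply ModuleCat.hom_ext
  refine LinearMap.ext fun m => ?_
  change π₁.hom (ι₁.hom m) + π₂.hom (ι₂.hom m) = (x + y) • m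
  rw [apply_apply_eq_smul_of_comp_eq_smul_id h₁, apply_apply_eq_smul_of_comp_eq_smul_id h₂, add_smul]

omit [IsNoetherianRing T] in
/-- The stable annihilator of a module contains `0` (factor through the zero module). [folklore] -/
theorem stablyAnnihilates_zero (M : ModuleCat.{u} T) : StablyAnnihilates T 0 M :=
  ⟨ModuleCat.of T PUnit.{u + 1}, inferInstance, projective_punit, 0, 0, by simp⟩

/-- **`ca(T) = ⋂ᵢ s̲ann(Xᵢ)`** for a covering recurrent class given as a family `X : ι → ModuleCat T`
(`hrec`: each `X j` is a retract of a first syzygy module of some `X j'`; `hcov`: every `d`-th syzygy module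
is a retract of some `X j`): `x ∈ ca(T)` iff `x` stably annihilates every `X j`.  (The right-hand side is an
ideal: `stablyAnnihilates_add`, `stablyAnnihilates_zero`, `StablyAnnihilates.mul_left`.) [folklore] -/
theorem mem_cohomologyAnnihilator_iff_forall_stablyAnnihilates_family {ι : Type*} (X : ι → ModuleCat.{u} T)
    (d : ℕ) (hfin : ∀ j, Module.Finite T (X j))
    (hrec : ∀ j, ∃ (j' : ι) (N : ModuleCat.{u} T) (i : X j ⟶ N) (r : N ⟶ X j),
      IsSyzygy 1 (X j') N ∧ i ≫ r = 𝟙 (X j))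
    (hcov : ∀ (M K : ModuleCat.{u} T), Module.Finite T M → IsSyzygy d M K →
      ∃ (j : ι) (i : K ⟶ X j) (r : X j ⟶ K), i ≫ r = 𝟙 K) (x : T) :
    x ∈ cohomologyAnnihilator T ↔ ∀ j : ι, StablyAnnihilates T x (X j) := by
  have key := mem_cohomologyAnnihilator_iff_forall_stablyAnnihilates_of_recurrent_of_cover
    (fun Y => ∃ j, Y = X j) d (fun Y ⟨j, hj⟩ => hj ▸ hfin j)
    (fun Y ⟨j, hj⟩ => by
      subst hj
      obtain ⟨j', N, i, r, hN, hir⟩ := hrec j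
      exact ⟨X j', N, i, r, ⟨j', rfl⟩, hN, hir⟩)
    (fun M K hM hK => by
      obtain ⟨j, i, r, hir⟩ := hcov M K hM hK
      exact ⟨X j, i, r, ⟨j, rfl⟩, hir⟩)
  rw [key x]
  constructor
  · intro h j
    exact h (X j) ⟨j, rfl⟩
  · rintro h Y ⟨j, rfl⟩
    exact h j

/-- Family form of the exclusion: ONE `X j₀` not stably annihilated by `x` puts `x` outside `caᵐ(T)` for every
`m` (the cover hypothesis is not needed for this direction). [folklore] -/
theorem not_mem_cohomologyAnnihilatorOfDegree_family {ι : Type*} (X : ι → ModuleCat.{u} T)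
    (hfin : ∀ j, Module.Finite T (X j))
    (hrec : ∀ j, ∃ (j' : ι) (N : ModuleCat.{u} T) (i : X j ⟶ N) (r : N ⟶ X j),
      IsSyzygy 1 (X j') N ∧ i ≫ r = 𝟙 (X j))
    {x : T} (j₀ : ι) (hx : ¬ StablyAnnihilates T x (X j₀)) (m : ℕ) :
    x ∉ cohomologyAnnihilatorOfDegree T m :=
  not_mem_cohomologyAnnihilatorOfDegree_of_recurrent (fun Y => ∃ j, Y = X j)
    (fun Y ⟨j, hj⟩ => hj ▸ hfin j)
    (fun Y ⟨j, hj⟩ => by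
      subst hj
      obtain ⟨j', N, i, r, hN, hir⟩ := hrec j
      exact ⟨X j', N, i, r, ⟨j', rfl⟩, hN, hir⟩)
    ⟨j₀, rfl⟩ hx m

/-! ## Appendix (same seat, later the same day): stable annihilators DESCEND along syzygies -/

/-- **`s̲ann(X) ⊆ s̲ann(Ωˢ X)`**: if `x` stably annihilates a finitely generated `X` over a noetherian ring, then `x` stably
annihilates every `s`-th syzygy module `K` of `X` — `x` kills `Ext^{≥1}(X, −)`, hence `Ext¹(K, N) ↪ Ext^{1+s}(X, N)`
(injective dimension shifting, tree `ext_smul_eq_zero_of_isSyzygy`), hence `x • 𝟙_K` factors through the cover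
(`stablyAnnihilates_of_forall_smul_ext_one_eq_zero`).  (The step «s-ann(X) ⊆ s-ann(ΩX)» of the engines' eventual-image
argument, e.g. tri-2 TETRA-Q0 §6: `N* ∣ Ω D₂ ⇒ s̲ann(N*) ⊇ s̲ann(D₂)` with `stablyAnnihilates_of_retract_of_isSyzygy`.)
[cite: IyengarTakahashi2014, Remark 2.3, Remark 2.13] -/
theorem stablyAnnihilates_of_isSyzygy_of_stablyAnnihilates {x : T} {X K : ModuleCat.{u} T} (hX : Module.Finite T X)
    (h : StablyAnnihilates T x X) {s : ℕ} (hK : IsSyzygy s X K) : StablyAnnihilates T x K := by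
  haveI : Module.Finite T K := finite_of_isSyzygy s hX hK
  refine stablyAnnihilates_of_forall_smul_ext_one_eq_zero K fun N _ e => ?_
  exact ext_smul_eq_zero_of_isSyzygy s hK N 1 le_rfl x (fun e' => h.smul_ext_eq_zero N (by omega) e') e

/-- **A retract of a syzygy of `X` inherits the stable annihilator of `X`**: `Y ⊂⊕ Ωˢ X`, `x ∈ s̲ann(X)` ⇒
`x ∈ s̲ann(Y)`. [folklore] -/
theorem stablyAnnihilates_of_retract_of_isSyzygy {x : T} {X K Y : ModuleCat.{u} T} (hX : Module.Finite T X)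
    (h : StablyAnnihilates T x X) {s : ℕ} (hK : IsSyzygy s X K) (i : Y ⟶ K) (r : K ⟶ Y) (hir : i ≫ r = 𝟙 Y) :
    StablyAnnihilates T x Y :=
  StablyAnnihilates.of_retract i r hir (stablyAnnihilates_of_isSyzygy_of_stablyAnnihilates hX h hK)

/-- The stable annihilator is constant along the syzygies of a PERIODIC module: if `X` is a `p`-th syzygy of itself
(`p` arbitrary) and `K` any `s`-th syzygy of `X`, then `x ∈ s̲ann(K) → x ∈ s̲ann(X)` as soon as `X` is a retract of a
syzygy of `K` — packaged for the common case `X ⊂⊕ Ωᵗ K`. [folklore] -/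
theorem stablyAnnihilates_iff_of_retract_isSyzygy {x : T} {X K N : ModuleCat.{u} T} (hX : Module.Finite T X)
    {s : ℕ} (hK : IsSyzygy s X K) {t : ℕ} (hN : IsSyzygy t K N) (i : X ⟶ N) (r : N ⟶ X) (hir : i ≫ r = 𝟙 X) :
    StablyAnnihilates T x X ↔ StablyAnnihilates T x K :=
  ⟨fun h => stablyAnnihilates_of_isSyzygy_of_stablyAnnihilates hX h hK,
   fun h => stablyAnnihilates_of_retract_of_isSyzygy (finite_of_isSyzygy s hX hK) h hN i r hir⟩

end Summit.ResolutionOfSingularities.ResolutionOfSingularities.Theorems.HomologicalConductor.RecurrenceCover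

end
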